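import Mathlib
import Summits.KontsevichZagierPeriods.Zeta5Search.BrickKernelFrobeniusTwo

/-!
# BrickKernelHatTwo — the HAT factorisation of the CENTRE-FREE brick kernel at the prime `2`: the ODD poles of an EVEN
row descend TWO rows, `R_{2N+2}(2t−1) = Ĥ_N(t)·((t−N−1)(t+2N+1))^B·R_N(t)` with NO power of `2` (cell `pub-zeta5`, ct-1 g42)

HONEST FRAMING: systematic search; no irrationality claim unless certified.  INSTRUMENT identity of rational functions (any
field, `2 ≠ 0`) about `R_n = brickKernel A B 0 n`; nothing about `ζ(5)`/`ζ(3)`; no `γ`/record statement; records in print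
UNMOVED; NOTHING IS DISCHARGED (net named-fact debt 0).

WHY: on an even row `2N+2` the odd poles `2K+1` are the HOLES of the digit split.  The zeta5-irr chain either drops them
(`BrickLevelReduction`, `L + 1 ≤ A`: they are `O(p^A)`, cf. `BrickHoleCellsAllPrimes` at every prime) or — to run the
induction at EVERY level — reduces them to the row `N` below by the «hat» identity (`BrickHatReduction`, `BrickHoleWeight`:
`G = p^A·γ`, odd `p`).  At `p = 2` the hat identity is explicit, like the odd-row factorisations of `BrickKernelFrobeniusTwo`:

* **`brickKernel_two_even_row_odd`** — `R_{2N+2}(2t−1) = Ĥ_N(t)·((t−N−1)·(t+2N+1))^B·R_N(t)`,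
  `Ĥ_N(t) = ((N+1)·D)^{A−2B}·[∏_{1≤i≤N+1}(2t−2i−1)·∏_{1≤i≤N+1}(2t+2N+2i+1)]^B/[∏_{i≤N+1}(2t+2i−1)]^A`, `D = ∏_{i≤N}(2i+1)`:
  the pole `2K+1` of `R_{2N+2}` sits at `t = −K`, the pole `K` of `R_N` (`K ≤ N`), and there is NO prefactor `2^{A−B}` or
  `2^A` on the left — so the regular parts satisfy `g^{(2N+2)}_{2K+1}(2t−1) = 2^A·Ĥ·(…)^B·g^{(N)}_K(t)`: hole cells are `2^A`
  times a `2`-integral expansion over the row `N` (the `p = 2` form of «`G = p^A·γ`»);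
* `prod_range_even_odd_succ`, `prod_Icc_even_odd_succ`, `factorial_two_mul_add_two` — the splittings over `[0, 2N+2]`,
  `[1, 2N+2]` and `(2N+2)! = 2^{N+1}·N!·((N+1)·D)`.

Theorems only (0 `def`); nothing restated.
-/

namespace Summit.KontsevichZagierPeriods.Zeta5Search.BrickKernelHatTwo

open Finset Nat
open Summit.KontsevichZagierPeriods.Zeta5Search.BrickKernelFrobenius (brickKernel)
open Summit.KontsevichZagierPeriods.Zeta5Search.BrickKernelFrobeniusTwo (prod_range_even_odd prod_Icc_even_odd
  factorial_two_mul_succ)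

/-! ## Splitting products over `[0, 2N+2]` and `[1, 2N+2]` -/

/-- `∏_{m < 2N+3} f(m) = ∏_{i ≤ N+1} f(2i) · ∏_{i ≤ N} f(2i+1)`. [folklore] -/
theorem prod_range_even_odd_succ {M : Type*} [CommMonoid M] (f : ℕ → M) (N : ℕ) :
    ∏ m ∈ range (2 * N + 2 + 1), f m = (∏ i ∈ range (N + 1 + 1), f (2 * i)) * ∏ i ∈ range (N + 1), f (2 * i + 1) := by
  rw [show 2 * N + 2 + 1 = (2 * N + 1 + 1) + 1 by ring, Finset.prod_range_succ, prod_range_even_odd,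
    Finset.prod_range_succ _ (N + 1), show 2 * N + 1 + 1 = 2 * (N + 1) by ring]
  simp only [mul_assoc, mul_comm]

/-- `∏_{1 ≤ m ≤ 2N+2} f(m) = ∏_{1 ≤ i ≤ N+1} f(2i) · ∏_{i ≤ N} f(2i+1)`. [folklore] -/
theorem prod_Icc_even_odd_succ {M : Type*} [CommMonoid M] (f : ℕ → M) (N : ℕ) :
    ∏ m ∈ Icc 1 (2 * N + 2), f m = (∏ i ∈ Icc 1 (N + 1), f (2 * i)) * ∏ i ∈ range (N + 1), f (2 * i + 1) := by
  rw [show 2 * N + 2 = (2 * N + 1) + 1 by ring, Finset.prod_Icc_succ_top (by omega), prod_Icc_even_odd,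
    Finset.prod_Icc_succ_top (by omega), show 2 * N + 1 + 1 = 2 * (N + 1) by ring]
  simp only [mul_assoc, mul_comm]

/-- `(2N+2)! = 2^{N+1} · N! · ((N+1) · ∏_{i ≤ N}(2i+1))`. [folklore] -/
theorem factorial_two_mul_add_two (N : ℕ) :
    (2 * N + 2)! = 2 ^ (N + 1) * N ! * ((N + 1) * ∏ i ∈ range (N + 1), (2 * i + 1)) := by
  rw [show 2 * N + 2 = (2 * N + 1) + 1 by ring, Nat.factorial_succ, factorial_two_mul_succ, pow_succ]
  ring

section kernel

variable {K : Type*} [Field K]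

/-- The algebra of the hat factorisation: for `x ≠ 0` (here `x = 2`),
`(x^{N+1} e w)^C (q₁ (x^{N+1} a a₁))^B ((x^{N+1} a' a₁') q₂)^B / (q₃ (x^{N+1} b))^{C+2B}
 = (w^C (q₁ q₂)^B / q₃^{C+2B}) · (a₁ a₁')^B · (e^C a^B a'^B / b^{C+2B})`. [folklore] -/
private theorem algebra {x : K} (hx : x ≠ 0) (N B C : ℕ) (a a₁ a' a₁' b e w q₁ q₂ q₃ : K) :
    (x ^ (N + 1) * e * w) ^ C * (q₁ * (x ^ (N + 1) * a * a₁)) ^ B * ((x ^ (N + 1) * a' * a₁') * q₂) ^ B /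
        (q₃ * (x ^ (N + 1) * b)) ^ (C + 2 * B) =
      (w ^ C * (q₁ * q₂) ^ B / q₃ ^ (C + 2 * B)) * (a₁ * a₁') ^ B * (e ^ C * a ^ B * a' ^ B / b ^ (C + 2 * B)) := by
  rcases Nat.eq_zero_or_pos (C + 2 * B) with h0 | h0
  · have hC : C = 0 := by omega
    have hB : B = 0 := by omega
    subst hC; subst hB
    simp
  by_cases hb : b = 0
  · subst hb; simp [zero_pow h0.ne']
  by_cases hq : q₃ = 0
  · subst hq; simp [zero_pow h0.ne']
  field_simp
  ring

/-- **Even row, odd poles — the hat factorisation at `2`**: for `2B ≤ A`, `(2 : K) ≠ 0`, every `N`, `t`: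
`R_{2N+2}(2t−1) = Ĥ_N(t)·((t−N−1)·(t+2N+1))^B·R_N(t)`,
`Ĥ_N(t) = ((N+1)·∏_{i≤N}(2i+1))^{A−2B}·[∏_{1≤i≤N+1}(2t−2i−1)·∏_{1≤i≤N+1}(2t+2N+2i+1)]^B/[∏_{i≤N+1}(2t+2i−1)]^A`.
The pole `2K+1` of `R_{2N+2}` is at `t = −K`, the pole `K` of `R_N`; no power of `2` appears. -/
theorem brickKernel_two_even_row_odd {A B : ℕ} (hAB : 2 * B ≤ A) (h2 : (2 : K) ≠ 0) (N : ℕ) (t : K) :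
    brickKernel A B 0 (2 * N + 2) (2 * t - 1) =
      ((((N : K) + 1) * ∏ i ∈ range (N + 1), (2 * (i : K) + 1)) ^ (A - 2 * B) *
          ((∏ i ∈ Icc 1 (N + 1), (2 * t - 2 * i - 1)) * ∏ i ∈ Icc 1 (N + 1), (2 * t + 2 * N + 2 * i + 1)) ^ B /
          (∏ i ∈ range (N + 1 + 1), (2 * t + 2 * i - 1)) ^ A) *
        ((t - N - 1) * (t + 2 * N + 1)) ^ B * brickKernel A B 0 N t := by
  obtain ⟨C, rfl⟩ : ∃ C, A = C + 2 * B := ⟨A - 2 * B, by omega⟩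
  have e1 : ∏ m ∈ range (2 * N + 2 + 1), (2 * t - 1 + (m : K)) =
      (∏ i ∈ range (N + 1 + 1), (2 * t + 2 * i - 1)) * ((2 : K) ^ (N + 1) * ∏ i ∈ range (N + 1), (t + (i : K))) := by
    rw [prod_range_even_odd_succ (fun m => 2 * t - 1 + (m : K)) N]
    congr 1
    · exact Finset.prod_congr rfl fun i _ => by push_cast; ring
    · have h : ∏ i ∈ range (N + 1), (2 * t - 1 + ((2 * i + 1 : ℕ) : K)) = ∏ i ∈ range (N + 1), (2 * (t + (i : K))) :=
        Finset.prod_congr rfl fun i _ => by push_cast; ring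
      rw [h, Finset.prod_mul_distrib, Finset.prod_const, Finset.card_range]
  have e2 : ∏ m ∈ Icc 1 (2 * N + 2), (2 * t - 1 - (m : K)) =
      (∏ i ∈ Icc 1 (N + 1), (2 * t - 2 * i - 1)) *
        ((2 : K) ^ (N + 1) * (∏ i ∈ Icc 1 N, (t - (i : K))) * (t - N - 1)) := by
    rw [prod_Icc_even_odd_succ (fun m => 2 * t - 1 - (m : K)) N]
    congr 1
    · exact Finset.prod_congr rfl fun i _ => by push_cast; ring
    · have h : ∏ i ∈ range (N + 1), (2 * t - 1 - ((2 * i + 1 : ℕ) : K)) =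
          ∏ i ∈ range (N + 1), (2 * (t - ((i + 1 : ℕ) : K))) :=
        Finset.prod_congr rfl fun i _ => by push_cast; ring
      have h' : ∏ i ∈ range N, (t - ((i + 1 : ℕ) : K)) = ∏ i ∈ Icc 1 N, (t - (i : K)) := by
        rw [← Finset.Ico_add_one_right_eq_Icc, Finset.prod_Ico_eq_prod_range, Nat.add_sub_cancel]
        exact Finset.prod_congr rfl fun i _ => by push_cast; ring
      rw [h, Finset.prod_mul_distrib, Finset.prod_const, Finset.card_range,
        Finset.prod_range_succ (fun i => t - ((i + 1 : ℕ) : K)) N, h']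
      push_cast; ring
  have e3 : ∏ m ∈ Icc 1 (2 * N + 2), (2 * t - 1 + ((2 * N + 2 : ℕ) : K) + (m : K)) =
      ((2 : K) ^ (N + 1) * (∏ i ∈ Icc 1 N, (t + N + (i : K))) * (t + 2 * N + 1)) *
        ∏ i ∈ Icc 1 (N + 1), (2 * t + 2 * N + 2 * i + 1) := by
    rw [prod_Icc_even_odd_succ (fun m => 2 * t - 1 + ((2 * N + 2 : ℕ) : K) + (m : K)) N, mul_comm]
    congr 1
    · have h : ∏ i ∈ range (N + 1), (2 * t - 1 + ((2 * N + 2 : ℕ) : K) + ((2 * i + 1 : ℕ) : K)) =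
          ∏ i ∈ range (N + 1), (2 * (t + N + ((i + 1 : ℕ) : K))) :=
        Finset.prod_congr rfl fun i _ => by push_cast; ring
      have h' : ∏ i ∈ range N, (t + N + ((i + 1 : ℕ) : K)) = ∏ i ∈ Icc 1 N, (t + N + (i : K)) := by
        rw [← Finset.Ico_add_one_right_eq_Icc, Finset.prod_Ico_eq_prod_range, Nat.add_sub_cancel]
        exact Finset.prod_congr rfl fun i _ => by push_cast; ring
      rw [h, Finset.prod_mul_distrib, Finset.prod_const, Finset.card_range,
        Finset.prod_range_succ (fun i => t + N + ((i + 1 : ℕ) : K)) N, h']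
      push_cast; ring
    · exact Finset.prod_congr rfl fun i _ => by push_cast; ring
  have e4 : (((2 * N + 2)! : ℕ) : K) =
      (2 : K) ^ (N + 1) * (N ! : K) * (((N : K) + 1) * ∏ i ∈ range (N + 1), (2 * (i : K) + 1)) := by
    rw [factorial_two_mul_add_two]; push_cast; rfl
  unfold brickKernel
  rw [Nat.add_sub_cancel, pow_zero, pow_zero, mul_one, mul_one, e1, e2, e3, e4]
  have key := algebra h2 N B C (∏ i ∈ Icc 1 N, (t - (i : K))) (t - N - 1) (∏ i ∈ Icc 1 N, (t + N + (i : K)))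
    (t + 2 * N + 1) (∏ i ∈ range (N + 1), (t + (i : K))) (N ! : K)
    (((N : K) + 1) * ∏ i ∈ range (N + 1), (2 * (i : K) + 1))
    (∏ i ∈ Icc 1 (N + 1), (2 * t - 2 * i - 1)) (∏ i ∈ Icc 1 (N + 1), (2 * t + 2 * N + 2 * i + 1))
    (∏ i ∈ range (N + 1 + 1), (2 * t + 2 * i - 1))
  linear_combination key

end kernel

end Summit.KontsevichZagierPeriods.Zeta5Search.BrickKernelHatTwo
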